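import Mathlib
import Summits.Ventures.PercRepro2.Defs
import Summits.Ventures.PercRepro2.Independence
import Summits.Ventures.PercRepro2.Harris
import Summits.Ventures.PercRepro2.Graph
import Summits.Ventures.PercRepro2.Events
import Summits.Ventures.PercRepro2.BHKEvents
import Summits.Ventures.PercRepro2.BHKAvoidWeighted
import Summits.Ventures.PercRepro2.BasePendant
import Summits.Ventures.PercRepro2.PsiPendantLemmas

/-!
# Pendant vertices reduce the (Ψ) inequality, III: the conditioning vertex (PercRepro2, p2)

The case `v = u` of the pendant reductions of `PsiPendant.lean` (P2-G17-PSI.md §3.3): if the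
conditioning vertex `u ∉ {s, t, o}` has the single edge `f = {u, y}`, then (Ψ)_𝓤 under `p[f↦1]`
(the instance with `u` glued to `y`) implies (Ψ)_𝓤 under `p` — every mass containing `{u ∈ C_s}`
is `p f` times its `f`-contracted value (`u ∈ C_s` forces `f` open), the `f`-free masses are
invariant, and the two regimes of `Cov_μ(1[o ∈ C_s ∪ C_t], 1[u ∈ C_s])` are handled by the
hypothesis and by `bhk_cross_cluster` respectively (`psi_cond_algebra`).
-/

namespace Summit.Ventures.PercRepro2

section PsiPendant

variable {V : Type*} {E : Type*} [Fintype E] [DecidableEq E] [Fintype V] [DecidableEq V]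
  {R : Type*} [CommRing R] [LinearOrder R] [IsStrictOrderedRing R]

/-- **Pendant conditioning vertex.** Let `u ∉ {s, t, o}` have the single edge `f = {u, y}`. If the
(Ψ) inequality on `𝓤` holds with `f` pinned open (the instance with `u` glued to `y`), it holds
under `p`. -/
theorem psi_pendant_cond (p : E → R) (hp : IsProbVec p) (ends : E → Sym2 V) (s t o u y : V)
    (f : E) (hf : ends f = s(u, y)) (hleaf : ∀ e, u ∈ ends e → e = f) (huy : u ≠ y)
    (hus : u ≠ s) (hut : u ≠ t) (huo : u ≠ o) {𝓤 : Set (Set V)} (h𝓤 : IsUpperSet 𝓤)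
    (h𝓤U : ∀ W ∈ 𝓤, u ∈ W)
    (h1 : prob (Function.update p f 1) (clusterInEvent ends s 𝓤 ∩ clusterInEvent ends t {W : Set V | o ∈ W} ∩
          (connEvent ends s t)ᶜ) * prob (Function.update p f 1) (connEvent ends s t)ᶜ * prob (Function.update p f 1) (connEvent ends s t)ᶜ ≤
      prob (Function.update p f 1) (clusterInEvent ends s 𝓤 ∩ (connEvent ends s t)ᶜ) *
        ((prob (Function.update p f 1) (connEvent ends s t)ᶜ - prob (Function.update p f 1) (connEvent ends s u ∩ (connEvent ends s t)ᶜ)) *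
            prob (Function.update p f 1) (clusterInEvent ends t {W : Set V | o ∈ W} ∩ (connEvent ends s t)ᶜ) +
          prob (Function.update p f 1) (connEvent ends s t)ᶜ *
            (prob (Function.update p f 1) (connEvent ends s u ∩ clusterInEvent ends t {W : Set V | o ∈ W} ∩
          (connEvent ends s t)ᶜ) +
              prob (Function.update p f 1) (connEvent ends s u ∩ clusterInEvent ends s {W : Set V | o ∈ W} ∩
          (connEvent ends s t)ᶜ)) -
          prob (Function.update p f 1) (connEvent ends s u ∩ (connEvent ends s t)ᶜ) *
            prob (Function.update p f 1) (clusterInEvent ends s {W : Set V | o ∈ W} ∩ (connEvent ends s t)ᶜ))) :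
    prob p (clusterInEvent ends s 𝓤 ∩ clusterInEvent ends t {W : Set V | o ∈ W} ∩
          (connEvent ends s t)ᶜ) * prob p (connEvent ends s t)ᶜ * prob p (connEvent ends s t)ᶜ ≤
      prob p (clusterInEvent ends s 𝓤 ∩ (connEvent ends s t)ᶜ) *
        ((prob p (connEvent ends s t)ᶜ - prob p (connEvent ends s u ∩ (connEvent ends s t)ᶜ)) *
            prob p (clusterInEvent ends t {W : Set V | o ∈ W} ∩ (connEvent ends s t)ᶜ) +
          prob p (connEvent ends s t)ᶜ *
            (prob p (connEvent ends s u ∩ clusterInEvent ends t {W : Set V | o ∈ W} ∩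
          (connEvent ends s t)ᶜ) +
              prob p (connEvent ends s u ∩ clusterInEvent ends s {W : Set V | o ∈ W} ∩
          (connEvent ends s t)ᶜ)) -
          prob p (connEvent ends s u ∩ (connEvent ends s t)ᶜ) *
            prob p (clusterInEvent ends s {W : Set V | o ∈ W} ∩ (connEvent ends s t)ᶜ)) := by
  have hw : 0 ≤ p f := hp.nonneg f
  have hw1 : p f ≤ 1 := hp.le_one f
  have hp1 : IsProbVec (Function.update p f 1) := hp.update f zero_le_one le_rfl
  -- f-free events: Q, {o ∈ C_t}, {o ∈ C_s}
  have hQ : ∀ (ω : Config E), Function.update ω f true ∈ (connEvent ends s t)ᶜ ↔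
      ω ∈ (connEvent ends s t)ᶜ := fun ω => by
    simp only [Set.mem_compl_iff, mem_connEvent]
    rw [conn_update_leaf_iff hf hleaf huy true hus.symm hut.symm]
  have hOL : ∀ (ω : Config E), Function.update ω f true ∈ clusterInEvent ends t {W : Set V | o ∈ W} ↔
      ω ∈ clusterInEvent ends t {W : Set V | o ∈ W} := fun ω => by
    simp only [mem_clusterInEvent, Set.mem_setOf_eq, mem_cluster]
    exact conn_update_leaf_iff hf hleaf huy true hut.symm huo.symm
  have hOH : ∀ (ω : Config E), Function.update ω f true ∈ clusterInEvent ends s {W : Set V | o ∈ W} ↔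
      ω ∈ clusterInEvent ends s {W : Set V | o ∈ W} := fun ω => by
    simp only [mem_clusterInEvent, Set.mem_setOf_eq, mem_cluster]
    exact conn_update_leaf_iff hf hleaf huy true hus.symm huo.symm
  have eQ1 := prob_update_one_of_invariant p f hQ
  have eOL1 := prob_update_one_of_invariant p f (A := clusterInEvent ends t {W : Set V | o ∈ W} ∩
    (connEvent ends s t)ᶜ) (fun ω => by simp only [Set.mem_inter_iff, hOL, hQ])
  have eOH1 := prob_update_one_of_invariant p f (A := clusterInEvent ends s {W : Set V | o ∈ W} ∩
    (connEvent ends s t)ᶜ) (fun ω => by simp only [Set.mem_inter_iff, hOH, hQ])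
  -- the events containing {u ∈ C_s} force f open
  have hAUsub : connEvent ends s u ⊆ openEdge f := fun ω hω =>
    mem_openEdge_of_conn_leaf hf hleaf huy hus.symm hω
  have hUsub : clusterInEvent ends s 𝓤 ⊆ openEdge f := fun ω hω =>
    mem_openEdge_of_conn_leaf hf hleaf huy hus.symm (h𝓤U _ hω)
  have eAU : prob p (connEvent ends s u ∩ (connEvent ends s t)ᶜ) = p f * prob (Function.update p f 1) (connEvent ends s u ∩ (connEvent ends s t)ᶜ) :=
    prob_eq_mul_prob_update_one_of_subset p f (Set.inter_subset_left.trans hAUsub)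
  have eAOL : prob p (connEvent ends s u ∩ clusterInEvent ends t {W : Set V | o ∈ W} ∩
          (connEvent ends s t)ᶜ) = p f * prob (Function.update p f 1) (connEvent ends s u ∩ clusterInEvent ends t {W : Set V | o ∈ W} ∩
          (connEvent ends s t)ᶜ) :=
    prob_eq_mul_prob_update_one_of_subset p f
      (Set.inter_subset_left.trans (Set.inter_subset_left.trans hAUsub))
  have eAOH : prob p (connEvent ends s u ∩ clusterInEvent ends s {W : Set V | o ∈ W} ∩
          (connEvent ends s t)ᶜ) = p f * prob (Function.update p f 1) (connEvent ends s u ∩ clusterInEvent ends s {W : Set V | o ∈ W} ∩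
          (connEvent ends s t)ᶜ) :=
    prob_eq_mul_prob_update_one_of_subset p f
      (Set.inter_subset_left.trans (Set.inter_subset_left.trans hAUsub))
  have eU : prob p (clusterInEvent ends s 𝓤 ∩ (connEvent ends s t)ᶜ) = p f * prob (Function.update p f 1) (clusterInEvent ends s 𝓤 ∩ (connEvent ends s t)ᶜ) :=
    prob_eq_mul_prob_update_one_of_subset p f (Set.inter_subset_left.trans hUsub)
  have eUOL : prob p (clusterInEvent ends s 𝓤 ∩ clusterInEvent ends t {W : Set V | o ∈ W} ∩
          (connEvent ends s t)ᶜ) = p f * prob (Function.update p f 1) (clusterInEvent ends s 𝓤 ∩ clusterInEvent ends t {W : Set V | o ∈ W} ∩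
          (connEvent ends s t)ᶜ) :=
    prob_eq_mul_prob_update_one_of_subset p f
      (Set.inter_subset_left.trans (Set.inter_subset_left.trans hUsub))
  -- the cross-cluster instance for the contracted weights
  have hcross := bhk_cross_cluster (Function.update p f 1) hp1 ends s t h𝓤 (isUpperSet_memFamily o)
  have hg : 0 ≤ prob (Function.update p f 1) (clusterInEvent ends s 𝓤 ∩ (connEvent ends s t)ᶜ) := prob_nonneg hp1 _
  have hq : 0 ≤ prob (Function.update p f 1) (connEvent ends s t)ᶜ := prob_nonneg hp1 _
  rw [eAU, eAOL, eAOH, eU, eUOL, ← eQ1, ← eOL1, ← eOH1]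
  exact psi_cond_algebra hw hw1 hg hq hcross h1

end PsiPendant

end Summit.Ventures.PercRepro2
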